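/- Free-seat work of EXTRA WIDTH SEAT `ym-line-cbag-p1-w4` (prover-ym-line-cbag-p1-w4-g2-0), route `EguchiKawaiDirectionLadder`
(ideator ym-idea-2, LINE 8), crux `TripleSmallBallMargin` (stmt-QuantumFields-27724): stages S9-meas + S9-asm of the LEAD's architecture
note (ARCH-27724-lead-g24.md §3(ii), stub S9 «Abs»): the pair-block Haar law (independent Haar block pairs on a label subset `T`, identity on
the other blocks), its absorption by `Haar_{U(N)} ⊗ Haar_{U(N)}`, and the DECOUPLING INEQUALITY
`Haar²(E) ≤ (∏_{b∈T} p_b) · Haar²(A₁ × A₂)`.  ROUTE-INDEPENDENT.  Nothing here bears on the Yang–Mills mass gap. -/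
import Summits.QuantumFields.YangMills.Theorems.EguchiKawaiDirectionLadderBlockDiagonalDefs
import Summits.QuantumFields.YangMills.Theorems.EguchiKawaiDirectionLadderHaarAbsorption
import HarnessLib

/-!
# Route `EguchiKawaiDirectionLadder`: the pair-block law and the one-level decoupling inequality (S9-meas / S9-asm)

Setting (eigenbasis of `U 0`; a labelling `ℓ : Fin N → Fin m` of the indices into blocks; a set `T` of labels — the blocks to be
decoupled; the others, e.g. the `𝒜`-blocks and the collar, are left alone).  For a pair of Haar links `(X, Y) ∈ U(N) × U(N)`:

* `blockPairHaar ℓ` — independent Haar PAIRS of block unitaries, `⊗_a (Haar_{U({ℓ=a})} ⊗ Haar_{U({ℓ=a})})`;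
  `fstOn T W`, `sndOn T W` — the block families `a ↦ (W a).1` resp. `(W a).2` on `a ∈ T` and `1` off `T`;
  `blockPairLaw ℓ T` — the law on `U(N) × U(N)` of `(ι(fstOn T W), ι(sndOn T W))` (a probability measure);
* ABSORPTION (`haar_prod_eq_lintegral_blockPair_fibre`): `Haar²(E) = ∫ blockPairLaw{Q | (X·Q₁, Y·Q₂) ∈ E} dHaar²(X,Y)` — the product group
  `U(N) × U(N)` with its right-invariant Haar ⊗ Haar absorbs the independent right factor (general lemma of `…HaarAbsorption`);
* BLOCK-LOCALITY (`blockPairHaar_pi_le`): the `blockPairHaar`-measure of «`W b ∈ F_b` for all `b ∈ T`» is `∏_{b∈T} (Haar_b⊗Haar_b)(F_b)`;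
* **THE DECOUPLING INEQUALITY** (`haar_prod_le_prod_mul_of_blockPair_fibres`): if membership of `(X·ι(D), Y·ι(D′))` in `E` (for block families
  `D, D′` equal to `1` off `T`) forces `X ∈ A₁`, `Y ∈ A₂` and block-local conditions `(D_b, D′_b) ∈ F_b(X,Y)` (`b ∈ T`), and each
  `(Haar_b⊗Haar_b)(F_b(X,Y)) ≤ p_b` uniformly over `X ∈ A₁, Y ∈ A₂`, then `Haar²(E) ≤ (∏_{b∈T} p_b) · Haar²(A₁ ×ˢ A₂)`.
  In the crux (§3(ii)–(iii) of the note): `A_i` = the entrywise-rigidity events of `X`, `Y` (invariant under right block multiplication on `T`,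
  `…BlockPairAlgebra`), `F_b` = the robust pair event for `(X_{bb}D_b, Y_{bb}D′_b)` with the D-uniform slacks, and `p_b` = the rank-robust pair
  small-ball bound transported by `haar_prod_robustPairEvent_transfer`.

HONEST FRAMING: measure-theoretic bookkeeping; no small-ball estimate is proved here.  The route bears on the barrier-ledger fact
`EguchiKawaiBreakdown` only.
-/

set_option autoImplicit false

noncomputable section

open MeasureTheory
open scoped Matrix ENNReal
open Literature.Barriers.QuantumFields

namespace Summit.QuantumFields.YangMills.Theorems.EguchiKawaiDirectionLadder

variable {N m : ℕ}

/-! ### §1 The pair-block law -/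

/-- A family of PAIRS of block unitaries. -/
abbrev BlockUnitaryPairs (ℓ : Fin N → Fin m) : Type :=
  (a : Fin m) → Matrix.unitaryGroup {i : Fin N // ℓ i = a} ℂ × Matrix.unitaryGroup {i : Fin N // ℓ i = a} ℂ

/-- Independent Haar pairs of block unitaries: `⊗_a (Haar ⊗ Haar)`. -/
def blockPairHaar (ℓ : Fin N → Fin m) : Measure (BlockUnitaryPairs ℓ) :=
  Measure.pi fun a =>
    (Literature.MathematicalPhysics.QuantumFieldTheory.haarProbability (Matrix.unitaryGroup {i : Fin N // ℓ i = a} ℂ)).prod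
      (Literature.MathematicalPhysics.QuantumFieldTheory.haarProbability (Matrix.unitaryGroup {i : Fin N // ℓ i = a} ℂ))

/-- `blockPairHaar ℓ` is a probability measure. -/
theorem isProbabilityMeasure_blockPairHaar (ℓ : Fin N → Fin m) : IsProbabilityMeasure (blockPairHaar ℓ) := by
  unfold blockPairHaar; infer_instance

/-- The first block family on `T` (identity off `T`). -/
def fstOn {ℓ : Fin N → Fin m} (T : Finset (Fin m)) (W : BlockUnitaryPairs ℓ) : BlockUnitaries ℓ :=
  fun a => if a ∈ T then (W a).1 else 1

/-- The second block family on `T` (identity off `T`). -/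
def sndOn {ℓ : Fin N → Fin m} (T : Finset (Fin m)) (W : BlockUnitaryPairs ℓ) : BlockUnitaries ℓ :=
  fun a => if a ∈ T then (W a).2 else 1

/-- Off `T` the first family is the identity. -/
theorem fstOn_of_not_mem {ℓ : Fin N → Fin m} {T : Finset (Fin m)} (W : BlockUnitaryPairs ℓ) {a : Fin m} (ha : a ∉ T) :
    fstOn T W a = 1 := by simp [fstOn, ha]

/-- Off `T` the second family is the identity. -/
theorem sndOn_of_not_mem {ℓ : Fin N → Fin m} {T : Finset (Fin m)} (W : BlockUnitaryPairs ℓ) {a : Fin m} (ha : a ∉ T) :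
    sndOn T W a = 1 := by simp [sndOn, ha]

/-- On `T` the first family is the first component. -/
theorem fstOn_of_mem {ℓ : Fin N → Fin m} {T : Finset (Fin m)} (W : BlockUnitaryPairs ℓ) {a : Fin m} (ha : a ∈ T) :
    fstOn T W a = (W a).1 := by simp [fstOn, ha]

/-- On `T` the second family is the second component. -/
theorem sndOn_of_mem {ℓ : Fin N → Fin m} {T : Finset (Fin m)} (W : BlockUnitaryPairs ℓ) {a : Fin m} (ha : a ∈ T) :
    sndOn T W a = (W a).2 := by simp [sndOn, ha]

/-- `fstOn T` is continuous. -/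
theorem continuous_fstOn {ℓ : Fin N → Fin m} (T : Finset (Fin m)) : Continuous (fstOn (ℓ := ℓ) T) := by
  refine continuous_pi fun a => ?_
  by_cases ha : a ∈ T
  · simp only [fstOn, ha, if_true]; exact continuous_fst.comp (continuous_apply a)
  · simp only [fstOn, ha, if_false]; exact continuous_const

/-- `sndOn T` is continuous. -/
theorem continuous_sndOn {ℓ : Fin N → Fin m} (T : Finset (Fin m)) : Continuous (sndOn (ℓ := ℓ) T) := by
  refine continuous_pi fun a => ?_
  by_cases ha : a ∈ T
  · simp only [sndOn, ha, if_true]; exact continuous_snd.comp (continuous_apply a)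
  · simp only [sndOn, ha, if_false]; exact continuous_const

/-- The packaging map `W ↦ (ι(fstOn T W), ι(sndOn T W)) ∈ U(N) × U(N)`. -/
def blockPairEmbed (ℓ : Fin N → Fin m) (T : Finset (Fin m)) (W : BlockUnitaryPairs ℓ) : UN N × UN N :=
  (blockDiagUnitary ℓ (fstOn T W), blockDiagUnitary ℓ (sndOn T W))

/-- The packaging map is measurable. -/
theorem measurable_blockPairEmbed (ℓ : Fin N → Fin m) (T : Finset (Fin m)) : Measurable (blockPairEmbed ℓ T) := by
  haveI : ∀ a : Fin m, SecondCountableTopology (Matrix.unitaryGroup {i : Fin N // ℓ i = a} ℂ) :=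
    secondCountableTopology_blockUnitary ℓ
  have hc : Continuous (blockPairEmbed ℓ T) :=
    ((continuous_blockDiagUnitary ℓ).comp (continuous_fstOn T)).prodMk
      ((continuous_blockDiagUnitary ℓ).comp (continuous_sndOn T))
  exact hc.measurable

/-- **The pair-block law** on `U(N) × U(N)`: independent Haar block pairs on `T`, identity elsewhere. -/
def blockPairLaw (ℓ : Fin N → Fin m) (T : Finset (Fin m)) : Measure (UN N × UN N) :=
  (blockPairHaar ℓ).map (blockPairEmbed ℓ T)

/-- `blockPairLaw ℓ T` is a probability measure. -/
theorem isProbabilityMeasure_blockPairLaw (ℓ : Fin N → Fin m) (T : Finset (Fin m)) :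
    IsProbabilityMeasure (blockPairLaw ℓ T) := by
  haveI := isProbabilityMeasure_blockPairHaar ℓ
  exact Measure.isProbabilityMeasure_map (measurable_blockPairEmbed ℓ T).aemeasurable

/-- The pair-block law of a measurable set is the `blockPairHaar`-measure of its preimage. -/
theorem blockPairLaw_apply (ℓ : Fin N → Fin m) (T : Finset (Fin m)) {S : Set (UN N × UN N)} (hS : MeasurableSet S) :
    blockPairLaw ℓ T S = blockPairHaar ℓ (blockPairEmbed ℓ T ⁻¹' S) := by
  unfold blockPairLaw; rw [Measure.map_apply (measurable_blockPairEmbed ℓ T) hS]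

/-! ### §2 Absorption by `Haar ⊗ Haar` and block-locality -/

/-- `Haar_{U(N)} ⊗ Haar_{U(N)}` is right-invariant on the product group. -/
theorem isMulRightInvariant_haar_prod :
    ((Literature.MathematicalPhysics.QuantumFieldTheory.haarProbability (UN N)).prod
      (Literature.MathematicalPhysics.QuantumFieldTheory.haarProbability (UN N))).IsMulRightInvariant := by
  haveI := isMulRightInvariant_haarUN (N := N)
  infer_instance

/-- **ABSORPTION**: `Haar²(E) = ∫ blockPairLaw{Q | (X·Q₁, Y·Q₂) ∈ E} dHaar²(X, Y)` for measurable `E`. -/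
theorem haar_prod_eq_lintegral_blockPair_fibre (ℓ : Fin N → Fin m) (T : Finset (Fin m)) {E : Set (UN N × UN N)}
    (hE : MeasurableSet E) :
    (Literature.MathematicalPhysics.QuantumFieldTheory.haarProbability (UN N)).prod
        (Literature.MathematicalPhysics.QuantumFieldTheory.haarProbability (UN N)) E =
      ∫⁻ P, blockPairLaw ℓ T {Q | P * Q ∈ E}
        ∂(Literature.MathematicalPhysics.QuantumFieldTheory.haarProbability (UN N)).prod
          (Literature.MathematicalPhysics.QuantumFieldTheory.haarProbability (UN N)) := by
  haveI := isMulRightInvariant_haar_prod (N := N)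
  haveI := isProbabilityMeasure_blockPairLaw ℓ T
  exact measure_eq_lintegral_fibre hE

/-- **BLOCK-LOCALITY**: if a set of block-pair families is contained in «`W b ∈ F b` for `b ∈ T`», its `blockPairHaar`-measure is at most
`∏_{b∈T} (Haar_b ⊗ Haar_b)(F b)`. -/
theorem blockPairHaar_le_prod (ℓ : Fin N → Fin m) (T : Finset (Fin m))
    (F : (a : Fin m) → Set (Matrix.unitaryGroup {i : Fin N // ℓ i = a} ℂ × Matrix.unitaryGroup {i : Fin N // ℓ i = a} ℂ))
    {S : Set (BlockUnitaryPairs ℓ)} (hS : ∀ W ∈ S, ∀ b ∈ T, W b ∈ F b) :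
    blockPairHaar ℓ S ≤ ∏ b ∈ T,
      ((Literature.MathematicalPhysics.QuantumFieldTheory.haarProbability (Matrix.unitaryGroup {i : Fin N // ℓ i = b} ℂ)).prod
        (Literature.MathematicalPhysics.QuantumFieldTheory.haarProbability (Matrix.unitaryGroup {i : Fin N // ℓ i = b} ℂ)))
        (F b) := by
  classical
  set G : (a : Fin m) → Set (Matrix.unitaryGroup {i : Fin N // ℓ i = a} ℂ × Matrix.unitaryGroup {i : Fin N // ℓ i = a} ℂ) :=
    fun a => if a ∈ T then F a else Set.univ with hG
  have hsub : S ⊆ Set.pi Set.univ G := by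
    intro W hW a _
    by_cases ha : a ∈ T
    · simp only [hG, ha, if_true]; exact hS W hW a ha
    · simp only [hG, ha, if_false, Set.mem_univ]
  calc blockPairHaar ℓ S ≤ blockPairHaar ℓ (Set.pi Set.univ G) := measure_mono hsub
    _ = ∏ a, ((Literature.MathematicalPhysics.QuantumFieldTheory.haarProbability
            (Matrix.unitaryGroup {i : Fin N // ℓ i = a} ℂ)).prod
          (Literature.MathematicalPhysics.QuantumFieldTheory.haarProbability
            (Matrix.unitaryGroup {i : Fin N // ℓ i = a} ℂ))) (G a) := by
        unfold blockPairHaar; exact Measure.pi_pi _ _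
    _ = ∏ b ∈ T, ((Literature.MathematicalPhysics.QuantumFieldTheory.haarProbability
            (Matrix.unitaryGroup {i : Fin N // ℓ i = b} ℂ)).prod
          (Literature.MathematicalPhysics.QuantumFieldTheory.haarProbability
            (Matrix.unitaryGroup {i : Fin N // ℓ i = b} ℂ))) (F b) := by
        rw [← Finset.prod_filter_mul_prod_filter_not Finset.univ (fun a => a ∈ T)]
        have h1 : Finset.univ.filter (fun a => a ∈ T) = T := by ext a; simp
        have h2 : ∏ a ∈ Finset.univ.filter (fun a => ¬a ∈ T),
            ((Literature.MathematicalPhysics.QuantumFieldTheory.haarProbability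
                (Matrix.unitaryGroup {i : Fin N // ℓ i = a} ℂ)).prod
              (Literature.MathematicalPhysics.QuantumFieldTheory.haarProbability
                (Matrix.unitaryGroup {i : Fin N // ℓ i = a} ℂ))) (G a) = 1 := by
          refine Finset.prod_eq_one fun a ha => ?_
          have ha' : a ∉ T := (Finset.mem_filter.1 ha).2
          simp only [hG, ha', if_false]
          exact measure_univ
        rw [h2, mul_one, h1]
        refine Finset.prod_congr rfl fun b hb => ?_
        simp only [hG, hb, if_true]

/-! ### §3 The one-level decoupling inequality -/

/-- **THE DECOUPLING INEQUALITY (S9).**  Let `E ⊆ U(N) × U(N)` be measurable, `A₁, A₂ ⊆ U(N)`, and for each label `b` and links `X, Y` a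
block-local set `F b X Y` of pairs of block unitaries with `(Haar_b⊗Haar_b)(F b X Y) ≤ p b` whenever `X ∈ A₁`, `Y ∈ A₂`.  If for all links
`X, Y` and all block-pair families `W`, membership `(X·ι(fstOn T W), Y·ι(sndOn T W)) ∈ E` forces `X ∈ A₁`, `Y ∈ A₂` and `W b ∈ F b X Y` for every
`b ∈ T`, then `Haar²(E) ≤ (∏_{b∈T} p b) · Haar²(A₁ ×ˢ A₂)`. -/
theorem haar_prod_le_prod_mul_of_blockPair_fibres (ℓ : Fin N → Fin m) (T : Finset (Fin m)) {E : Set (UN N × UN N)}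
    (hE : MeasurableSet E) (A₁ A₂ : Set (UN N))
    (F : (b : Fin m) → UN N → UN N →
      Set (Matrix.unitaryGroup {i : Fin N // ℓ i = b} ℂ × Matrix.unitaryGroup {i : Fin N // ℓ i = b} ℂ))
    (p : Fin m → ℝ≥0∞)
    (h1 : ∀ (X Y : UN N) (W : BlockUnitaryPairs ℓ),
      (X * blockDiagUnitary ℓ (fstOn T W), Y * blockDiagUnitary ℓ (sndOn T W)) ∈ E →
        X ∈ A₁ ∧ Y ∈ A₂ ∧ ∀ b ∈ T, W b ∈ F b X Y)
    (h2 : ∀ X ∈ A₁, ∀ Y ∈ A₂, ∀ b ∈ T,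
      ((Literature.MathematicalPhysics.QuantumFieldTheory.haarProbability (Matrix.unitaryGroup {i : Fin N // ℓ i = b} ℂ)).prod
        (Literature.MathematicalPhysics.QuantumFieldTheory.haarProbability (Matrix.unitaryGroup {i : Fin N // ℓ i = b} ℂ)))
        (F b X Y) ≤ p b) :
    (Literature.MathematicalPhysics.QuantumFieldTheory.haarProbability (UN N)).prod
        (Literature.MathematicalPhysics.QuantumFieldTheory.haarProbability (UN N)) E ≤
      (∏ b ∈ T, p b) *
        (Literature.MathematicalPhysics.QuantumFieldTheory.haarProbability (UN N)).prod
          (Literature.MathematicalPhysics.QuantumFieldTheory.haarProbability (UN N)) (A₁ ×ˢ A₂) := by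
  classical
  set μ := (Literature.MathematicalPhysics.QuantumFieldTheory.haarProbability (UN N)).prod
        (Literature.MathematicalPhysics.QuantumFieldTheory.haarProbability (UN N)) with hμ
  rw [haar_prod_eq_lintegral_blockPair_fibre ℓ T hE]
  -- fibrewise bound
  have hfib : ∀ P : UN N × UN N,
      blockPairLaw ℓ T {Q | P * Q ∈ E} ≤ (A₁ ×ˢ A₂).indicator (fun _ => ∏ b ∈ T, p b) P := by
    rintro ⟨X, Y⟩
    have hmeas : MeasurableSet {Q : UN N × UN N | (X, Y) * Q ∈ E} := (measurable_const_mul (X, Y)) hE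
    rw [blockPairLaw_apply ℓ T hmeas]
    -- the preimage, described through `h1`
    have hpre : ∀ W ∈ blockPairEmbed ℓ T ⁻¹' {Q : UN N × UN N | (X, Y) * Q ∈ E},
        X ∈ A₁ ∧ Y ∈ A₂ ∧ ∀ b ∈ T, W b ∈ F b X Y := by
      intro W hW
      simp only [Set.mem_preimage, Set.mem_setOf_eq, blockPairEmbed, Prod.mk_mul_mk] at hW
      exact h1 X Y W hW
    by_cases hP : (X, Y) ∈ A₁ ×ˢ A₂
    · rw [Set.indicator_of_mem hP]
      obtain ⟨hX, hY⟩ := Set.mem_prod.1 hP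
      calc blockPairHaar ℓ (blockPairEmbed ℓ T ⁻¹' {Q : UN N × UN N | (X, Y) * Q ∈ E})
          ≤ ∏ b ∈ T, ((Literature.MathematicalPhysics.QuantumFieldTheory.haarProbability
                (Matrix.unitaryGroup {i : Fin N // ℓ i = b} ℂ)).prod
              (Literature.MathematicalPhysics.QuantumFieldTheory.haarProbability
                (Matrix.unitaryGroup {i : Fin N // ℓ i = b} ℂ))) (F b X Y) :=
            blockPairHaar_le_prod ℓ T (fun b => F b X Y) fun W hW b hb => (hpre W hW).2.2 b hb
        _ ≤ ∏ b ∈ T, p b := Finset.prod_le_prod' fun b hb => h2 X hX Y hY b hb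
    · rw [Set.indicator_of_notMem hP]
      have hempty : blockPairEmbed ℓ T ⁻¹' {Q : UN N × UN N | (X, Y) * Q ∈ E} = ∅ := by
        ext W
        simp only [Set.mem_empty_iff_false, iff_false]
        intro hW
        obtain ⟨hX, hY, -⟩ := hpre W hW
        exact hP (Set.mk_mem_prod hX hY)
      rw [hempty, measure_empty]
  calc ∫⁻ P, blockPairLaw ℓ T {Q | P * Q ∈ E} ∂μ ≤ ∫⁻ P, (A₁ ×ˢ A₂).indicator (fun _ => ∏ b ∈ T, p b) P ∂μ :=
        lintegral_mono hfib
    _ ≤ (∏ b ∈ T, p b) * μ (A₁ ×ˢ A₂) := lintegral_indicator_const_le _ _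

end Summit.QuantumFields.YangMills.Theorems.EguchiKawaiDirectionLadder

end
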